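import Literature.NumberTheory.Automorphic.UnitaryResiduallyRegularOrbitalIntegralClosed   -- ★ p839524 (A-p01 (g20)): split place — `…_of_split` binders + closed heads; §1 products
import Literature.NumberTheory.Automorphic.UnitaryResiduallyRegularNonsplitPlace           -- ★ p839523 (A-p03 (g23)): non-split place — (w1) `hK1`, (w2) `hcore`
import Literature.NumberTheory.Automorphic.LocalStableConjSplitPlace                  -- ★ `coe_localSplitEquiv_apply` (`rfl`: the avatar matrix is the `w`-component)
import Literature.NumberTheory.Automorphic.UnramifiedOrbitSetAdelic                     -- ★ `coe_coe_localNonsplitEquiv_apply` (`rfl`, ditto at a non-split `w`)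
import HarnessLib

/-!
# The residually-regular unit orbital integral of the unitary group at EVERY unramified place of good reduction, CLOSED and CASE-FREE:
# `O_γ(1_{U(H)(𝒪_v)}) = vol U(H)(𝒪_v)` (and `= 1`, and the endoscopic pair group) with NO arithmetic binder and NO split ∕ non-split distinction

Topic `NumberTheory/Automorphic`; namespace `Literature.NumberTheory.Automorphic.UnitaryGroup`.  THEOREMS ONLY (no definition, no instance, no notation,
no named fact, no `sorry`).  Cell `hodgecm-mathlib`, F0∕P3a road letter «D-S3u» ED. 4 — the JUNCTION of ★ «D-S3u ED. 3» (A-p01 (g20), p839524: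
split place, along ★ `localSplitEquiv`) and ★ «D-S3u-INERT-WRAP» (A-p03 (g23), p839523: non-split place, along ★ `localNonsplitEquiv`) (LEAD F0P3a-plan
(g8) T7-75∕T7-83∕T7-85).  HONEST LABEL: HC_CM is proved only modulo the printed citations until rung 0 closes; this file proves NO letter and is
count-neutral — it is the residually-regular stratum of the unit fundamental lemma N7 (`O_γ(1_K) = 1` on both sides, [Rogawski1990, §4.9 Prop. 4.9.1 (b)])
in CLOSED FORM at every finite place `v` of `L⁺` UNRAMIFIED in `L` where `H` has GOOD REDUCTION — i.e. at all but finitely many `v` — with the residual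
regularity stated ONCE, on the `w`-component matrix `γ_w := (γ : GL_N(∏_{w′∣v} L_{w′})).map (eval w)`, which is `rfl`-equal to BOTH avatars
(★ `coe_localSplitEquiv_apply`, ★ `coe_coe_localNonsplitEquiv_apply`), so the split∕non-split case split happens INSIDE the proofs (`by_cases c • w = w`)
and never in a consumer's statement.

THE BINDERS DISCHARGED (of ★ p838979 §2 ∕ ★ p839174 §2′, at `γ_c := out c`, `K_v = U(H)(𝒪_v)` = ★ `cmLocalIntegralLevel`):
* `hK1` «one `K_v`-class in `(G·γ_c) ∩ K_v`» ⟸ **`forall_exists_mem_cmLocalIntegralLevel_conj_eq_of_separable_redMat`** (split: ★ `…_of_split` over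
  ★ D-S3c (c3); non-split: ★ A-p03 `forall_exists_mem_localIntegralLevel_conj_eq_of_isConj_of_separable_redMat` over ★ Kottwitz 7.1
  `integralConj_unitaryGroupOfForm`);
* `hcore` «`Z(γ_c) ∩ K_v = compactCore Z(γ_c)`» ⟸ **`setOf_mem_cmLocalIntegralLevel_eq_compactCore_of_separable_redMat`** (split: ★ `…_of_split` over
  ★ D-S3c (c4); non-split: ★ A-p03 `setOf_mem_localIntegralLevel_eq_compactCore_centralizer_of_nonsplit`).
FRAME: `(hc : c ≠ 1) (hH : ᵗH̄ = H) (w : PlacesOver L v) (hv : Algebra.IsUnramifiedIn (𝓞 L) v) (hHw : IsUnit H_w) (hHi : H_w ∈ GL_N(𝒪_w))`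
(`hv` is used only at a non-split `w`, `hH`∕`hHi` at a split one; both are «almost every `v`» conditions the consumers already carry), and residual regularity
`hγs : (charpoly γ_w).Separable`, `hsep : (charpoly (redMat γ_w)).Separable` (B-p14 (g29)'s ★ `IntegralReduction.redMat` idiom).
HEADS: §1 the two binders; §2 **`classOrbitalIntegral_indicator_cmLocalIntegralLevel_eq_of_isCanonical_of_separable_redMat`** (`= ν(K_v).toReal`), `_eq_one_`
(`vol K_v = 1`), `…_complex_…_eq_one_…` (the `ℂ`-valued `1_{K_v}` of ★ `IsLocalUnitTransfer`); §3 the endoscopic pair group `U(H₂) × U(H₁)`,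
`K_H = U(H₂)(𝒪_v) ×ˢ U(H₁)(𝒪_v)`: binders by ★ §1-products of p839524, heads **`…_prod_eq_of_isCanonical_of_separable_redMat`** and `…_complex_…_prod_eq_one_…`.
NOT HERE: ramified `v`, bad reduction, `hγs ⟸ hsep`; the `GL_n` closed layer (F0P3b-p01).

References: [Kottwitz1986] R. Kottwitz, *Stable trace formula: elliptic singular terms*, Math. Ann. 275 (1986), §7 Prop. 7.1, Cor. 7.3;
[Rogawski1990] §3.3 p. 21, §4.3 p. 43, §4.9 Prop. 4.9.1 (b) p. 55; [Tits1979] §3.9; [PlatonovRapinchuk1994] §5.1.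
-/

set_option autoImplicit false

noncomputable section

open MeasureTheory Measure Topology Set Filter Function NumberField IsDedekindDomain Literature.MeasureTheory.Group
open scoped ENNReal NNReal Matrix MatrixGroups

namespace Literature.NumberTheory.Automorphic.UnitaryGroup

open Literature.NumberTheory.Automorphic.IntegralReduction

/-! ## §1 The two binders at an unramified place of good reduction, case-free -/

section Binders

variable (L : Type) [Field L] [NumberField L] [IsCMField L] (N : ℕ) (H : Matrix (Fin N) (Fin N) L)
  {v : HeightOneSpectrum (𝓞 ↥(maximalRealSubfield L))}
  (hc : IsCMField.complexConj L ≠ 1) (hH : (H.map (IsCMField.complexConj L))ᵀ = H)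
  (w : PlacesOver L v) (hv : Algebra.IsUnramifiedIn (𝓞 L) v.asIdeal) (hHw : IsUnit (placeForm H w.1))
  (hHi : hHw.unit ∈ glInt N (w.1.adicCompletion L))

include hc hH hv hHi in
/-- **`hK1` FOR `U(H)(𝒪_v)` AT AN UNRAMIFIED PLACE OF GOOD REDUCTION, CASE-FREE**: for `γ ∈ K_v` whose `w`-component matrix `γ_w` has residually separable
characteristic polynomial, every `U(H)(L⁺_v)`-conjugate of `γ` in `K_v` is a `K_v`-conjugate — split `w`: ★ `forall_exists_mem_cmLocalIntegralLevel_conj_eq_of_split`;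
non-split `w`: ★ `forall_exists_mem_localIntegralLevel_conj_eq_of_isConj_of_separable_redMat` (both avatars have matrix `γ_w` by `rfl`).
[cite: Kottwitz1986, Prop. 7.1, Cor. 7.3] [cite: Rogawski1990, §3.3 p. 21; §4.9 p. 55] -/
theorem forall_exists_mem_cmLocalIntegralLevel_conj_eq_of_separable_redMat {γ : (cmDatum L N H).Local v}
    (hγ : γ ∈ cmLocalIntegralLevel L N H v)
    (hsep : (redMat ((γ.val : GL (Fin N) (LocalRing L v)).val.map
      (Pi.evalRingHom (fun w' : PlacesOver L v => w'.1.adicCompletion L) w))).charpoly.Separable) :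
    ∀ γ' ∈ cmLocalIntegralLevel L N H v, IsConj γ γ' → ∃ k ∈ cmLocalIntegralLevel L N H v, k * γ * k⁻¹ = γ' := by
  by_cases hw : IsCMField.complexConj L • w.1 = w.1
  · exact forall_exists_mem_localIntegralLevel_conj_eq_of_isConj_of_separable_redMat (IsCMField.complexConj L) N H hc w hw hH hv
      hHw hHi γ hγ (by rw [coe_coe_localNonsplitEquiv_apply]; exact hsep)
  · exact forall_exists_mem_cmLocalIntegralLevel_conj_eq_of_split L N H hc hH w hw hHw hHi hγ
      (by rw [coe_localSplitEquiv_apply]; exact hsep)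

include hc hH hHi in
/-- **`hcore` FOR `U(H)(𝒪_v)` AT A PLACE OF GOOD REDUCTION, CASE-FREE**: for `γ ∈ K_v` whose `w`-component matrix `γ_w` is residually regular (`hγs`, `hsep`),
`Z(γ) ∩ K_v = compactCore Z(γ)` — split `w`: ★ `setOf_mem_cmLocalIntegralLevel_eq_compactCore_of_split`; non-split `w`: ★
`setOf_mem_localIntegralLevel_eq_compactCore_centralizer_of_nonsplit`. [cite: Kottwitz1986, Prop. 7.1] [cite: Tits1979, §3.9] [cite: Rogawski1990, §4.3 p. 43] -/
theorem setOf_mem_cmLocalIntegralLevel_eq_compactCore_of_separable_redMat {γ : (cmDatum L N H).Local v}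
    (hγ : γ ∈ cmLocalIntegralLevel L N H v)
    (hγs : ((γ.val : GL (Fin N) (LocalRing L v)).val.map
      (Pi.evalRingHom (fun w' : PlacesOver L v => w'.1.adicCompletion L) w)).charpoly.Separable)
    (hsep : (redMat ((γ.val : GL (Fin N) (LocalRing L v)).val.map
      (Pi.evalRingHom (fun w' : PlacesOver L v => w'.1.adicCompletion L) w))).charpoly.Separable) :
    {z : ↥(Subgroup.centralizer ({γ} : Set ((cmDatum L N H).Local v))) | (z : (cmDatum L N H).Local v) ∈ cmLocalIntegralLevel L N H v} =
      compactCore ↥(Subgroup.centralizer ({γ} : Set ((cmDatum L N H).Local v))) := by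
  by_cases hw : IsCMField.complexConj L • w.1 = w.1
  · exact setOf_mem_localIntegralLevel_eq_compactCore_centralizer_of_nonsplit (IsCMField.complexConj L) N H hc w hw γ hγ
      (by rw [coe_coe_localNonsplitEquiv_apply]; exact hγs) (by rw [coe_coe_localNonsplitEquiv_apply]; exact hsep)
  · exact setOf_mem_cmLocalIntegralLevel_eq_compactCore_of_split L N H hc hH w hw hHw hHi hγ
      (by rw [coe_localSplitEquiv_apply]; exact hγs) (by rw [coe_localSplitEquiv_apply]; exact hsep)

/-! ## §2 The unit element of `U(H)(L⁺_v)` at a residually regular class, every unramified place of good reduction -/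

variable [MeasurableSpace ((cmDatum L N H).Local v)] [BorelSpace ((cmDatum L N H).Local v)]
  [∀ γ : (cmDatum L N H).Local v, MeasurableSpace ((cmDatum L N H).Local v ⧸ Subgroup.centralizer ({γ} : Set ((cmDatum L N H).Local v)))]
  [∀ γ : (cmDatum L N H).Local v, BorelSpace ((cmDatum L N H).Local v ⧸ Subgroup.centralizer ({γ} : Set ((cmDatum L N H).Local v)))]
  (ν : Measure ((cmDatum L N H).Local v)) [IsHaarMeasure ν] [ν.IsMulRightInvariant]

include hc hH hv hHi in
/-- **THE UNIT ELEMENT OF `U(H)(L⁺_v)` AT A RESIDUALLY REGULAR CLASS — CLOSED, EVERY UNRAMIFIED PLACE OF GOOD REDUCTION**: for `m` canonical for `(P, ν)`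
(★ `OrbitalMeasureFamily.IsCanonical`) and a `P`-class `c` whose representative `γ_c ∈ K_v = U(H)(𝒪_v)` has residually regular `w`-component (`hγs`, `hsep`):
**`classOrbitalIntegral m 1_{K_v} c = ν(K_v).toReal`** — ★ p838979 `classOrbitalIntegral_indicator_cmLocalIntegralLevel_eq_of_isCanonical` with `hK1`, `hcore` ≔ §1.
[cite: Rogawski1990, §4.3 p. 43; §4.9 Prop. 4.9.1 (b) p. 55] [cite: Kottwitz1986, Prop. 7.1] -/
theorem classOrbitalIntegral_indicator_cmLocalIntegralLevel_eq_of_isCanonical_of_separable_redMat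
    {P : (cmDatum L N H).Local v → Prop} {m : OrbitalMeasureFamily ((cmDatum L N H).Local v)} (hm : m.IsCanonical P ν)
    (c : ConjClasses ((cmDatum L N H).Local v)) (hPc : P (Quotient.out c))
    (hγ : (Quotient.out c : (cmDatum L N H).Local v) ∈ cmLocalIntegralLevel L N H v)
    (hγs : (((Quotient.out c : (cmDatum L N H).Local v).val : GL (Fin N) (LocalRing L v)).val.map
      (Pi.evalRingHom (fun w' : PlacesOver L v => w'.1.adicCompletion L) w)).charpoly.Separable)
    (hsep : (redMat (((Quotient.out c : (cmDatum L N H).Local v).val : GL (Fin N) (LocalRing L v)).val.map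
      (Pi.evalRingHom (fun w' : PlacesOver L v => w'.1.adicCompletion L) w))).charpoly.Separable) :
    classOrbitalIntegral m ((cmLocalIntegralLevel L N H v : Set ((cmDatum L N H).Local v)).indicator (1 : (cmDatum L N H).Local v → ℝ)) c =
      (ν (cmLocalIntegralLevel L N H v)).toReal :=
  classOrbitalIntegral_indicator_cmLocalIntegralLevel_eq_of_isCanonical L N H v ν hm c hPc hγ
    (forall_exists_mem_cmLocalIntegralLevel_conj_eq_of_separable_redMat L N H hc hH w hv hHw hHi hγ hsep)
    (setOf_mem_cmLocalIntegralLevel_eq_compactCore_of_separable_redMat L N H hc hH w hHw hHi hγ hγs hsep)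

include hc hH hv hHi in
/-- **`classOrbitalIntegral m 1_{U(H)(𝒪_v)} c = 1`** at `vol U(H)(𝒪_v) = 1`, every unramified place of good reduction, residually regular representative in `K_v`.
[cite: Rogawski1990, §4.9 Prop. 4.9.1 (b) p. 55] [cite: Kottwitz1986, Prop. 7.1] -/
theorem classOrbitalIntegral_indicator_cmLocalIntegralLevel_eq_one_of_isCanonical_of_separable_redMat
    {P : (cmDatum L N H).Local v → Prop} {m : OrbitalMeasureFamily ((cmDatum L N H).Local v)} (hm : m.IsCanonical P ν)
    (c : ConjClasses ((cmDatum L N H).Local v)) (hPc : P (Quotient.out c))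
    (hγ : (Quotient.out c : (cmDatum L N H).Local v) ∈ cmLocalIntegralLevel L N H v)
    (hγs : (((Quotient.out c : (cmDatum L N H).Local v).val : GL (Fin N) (LocalRing L v)).val.map
      (Pi.evalRingHom (fun w' : PlacesOver L v => w'.1.adicCompletion L) w)).charpoly.Separable)
    (hsep : (redMat (((Quotient.out c : (cmDatum L N H).Local v).val : GL (Fin N) (LocalRing L v)).val.map
      (Pi.evalRingHom (fun w' : PlacesOver L v => w'.1.adicCompletion L) w))).charpoly.Separable)
    (hν : ν (cmLocalIntegralLevel L N H v) = 1) :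
    classOrbitalIntegral m ((cmLocalIntegralLevel L N H v : Set ((cmDatum L N H).Local v)).indicator (1 : (cmDatum L N H).Local v → ℝ)) c = 1 :=
  classOrbitalIntegral_indicator_cmLocalIntegralLevel_eq_one_of_isCanonical L N H v ν hm c hPc hγ
    (forall_exists_mem_cmLocalIntegralLevel_conj_eq_of_separable_redMat L N H hc hH w hv hHw hHi hγ hsep)
    (setOf_mem_cmLocalIntegralLevel_eq_compactCore_of_separable_redMat L N H hc hH w hHw hHi hγ hγs hsep) hν

include hc hH hv hHi in
/-- **the letter's currency: `classOrbitalIntegral m (1_{U(H)(𝒪_v)} : G → ℂ) c = 1`** — the `G`-side summand of ★ `IsLocalUnitTransfer` at a residually regular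
class, every unramified place of good reduction, `vol U(H)(𝒪_v) = 1`; NO arithmetic binder and NO case distinction left.
[cite: Rogawski1990, §4.9 Prop. 4.9.1 (b) p. 55] [cite: Kottwitz1986, Prop. 7.1, Cor. 7.3] -/
theorem classOrbitalIntegral_indicator_complex_cmLocalIntegralLevel_eq_one_of_isCanonical_of_separable_redMat
    {P : (cmDatum L N H).Local v → Prop} {m : OrbitalMeasureFamily ((cmDatum L N H).Local v)} (hm : m.IsCanonical P ν)
    (c : ConjClasses ((cmDatum L N H).Local v)) (hPc : P (Quotient.out c))
    (hγ : (Quotient.out c : (cmDatum L N H).Local v) ∈ cmLocalIntegralLevel L N H v)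
    (hγs : (((Quotient.out c : (cmDatum L N H).Local v).val : GL (Fin N) (LocalRing L v)).val.map
      (Pi.evalRingHom (fun w' : PlacesOver L v => w'.1.adicCompletion L) w)).charpoly.Separable)
    (hsep : (redMat (((Quotient.out c : (cmDatum L N H).Local v).val : GL (Fin N) (LocalRing L v)).val.map
      (Pi.evalRingHom (fun w' : PlacesOver L v => w'.1.adicCompletion L) w))).charpoly.Separable)
    (hν : ν (cmLocalIntegralLevel L N H v) = 1) :
    classOrbitalIntegral m ((cmLocalIntegralLevel L N H v : Set ((cmDatum L N H).Local v)).indicator fun _ => (1 : ℂ)) c = 1 :=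
  classOrbitalIntegral_indicator_complex_cmLocalIntegralLevel_eq_one_of_isCanonical L N H v ν hm c hPc hγ
    (forall_exists_mem_cmLocalIntegralLevel_conj_eq_of_separable_redMat L N H hc hH w hv hHw hHi hγ hsep)
    (setOf_mem_cmLocalIntegralLevel_eq_compactCore_of_separable_redMat L N H hc hH w hHw hHi hγ hγs hsep) hν

end Binders

/-! ## §3 The endoscopic-side pair group `U(H₂)(L⁺_v) × U(H₁)(L⁺_v)` at every unramified place of good reduction for both factors -/

section Pair

variable (L : Type) [Field L] [NumberField L] [IsCMField L] (N₂ N₁ : ℕ) (H₂ : Matrix (Fin N₂) (Fin N₂) L) (H₁ : Matrix (Fin N₁) (Fin N₁) L)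
  {v : HeightOneSpectrum (𝓞 ↥(maximalRealSubfield L))}
  (hc : IsCMField.complexConj L ≠ 1) (hH₂ : (H₂.map (IsCMField.complexConj L))ᵀ = H₂) (hH₁ : (H₁.map (IsCMField.complexConj L))ᵀ = H₁)
  (w : PlacesOver L v) (hv : Algebra.IsUnramifiedIn (𝓞 L) v.asIdeal)
  (hH₂w : IsUnit (placeForm H₂ w.1)) (hH₁w : IsUnit (placeForm H₁ w.1))
  (hH₂i : hH₂w.unit ∈ glInt N₂ (w.1.adicCompletion L)) (hH₁i : hH₁w.unit ∈ glInt N₁ (w.1.adicCompletion L))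

include hc hH₂ hH₁ hv hH₂i hH₁i in
/-- **`hK1` for `K_H = U(H₂)(𝒪_v) ×ˢ U(H₁)(𝒪_v)`, case-free**, at every `γ ∈ K_H` whose two `w`-component matrices are residually separable: §1 per factor and ★
`forall_exists_conj_eq_prod`. [cite: Kottwitz1986, Prop. 7.1, Cor. 7.3] [cite: Rogawski1990, §4.9 p. 55] -/
theorem forall_exists_mem_cmLocalIntegralLevel_prod_conj_eq_of_separable_redMat {γ : (cmDatum L N₂ H₂).Local v × (cmDatum L N₁ H₁).Local v}
    (hγ : γ ∈ (cmLocalIntegralLevel L N₂ H₂ v).prod (cmLocalIntegralLevel L N₁ H₁ v))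
    (hsep₂ : (redMat ((γ.1.val : GL (Fin N₂) (LocalRing L v)).val.map
      (Pi.evalRingHom (fun w' : PlacesOver L v => w'.1.adicCompletion L) w))).charpoly.Separable)
    (hsep₁ : (redMat ((γ.2.val : GL (Fin N₁) (LocalRing L v)).val.map
      (Pi.evalRingHom (fun w' : PlacesOver L v => w'.1.adicCompletion L) w))).charpoly.Separable) :
    ∀ γ' ∈ (cmLocalIntegralLevel L N₂ H₂ v).prod (cmLocalIntegralLevel L N₁ H₁ v), IsConj γ γ' →
      ∃ k ∈ (cmLocalIntegralLevel L N₂ H₂ v).prod (cmLocalIntegralLevel L N₁ H₁ v), k * γ * k⁻¹ = γ' :=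
  forall_exists_conj_eq_prod (cmLocalIntegralLevel L N₂ H₂ v) (cmLocalIntegralLevel L N₁ H₁ v)
    (forall_exists_mem_cmLocalIntegralLevel_conj_eq_of_separable_redMat L N₂ H₂ hc hH₂ w hv hH₂w hH₂i (Subgroup.mem_prod.1 hγ).1 hsep₂)
    (forall_exists_mem_cmLocalIntegralLevel_conj_eq_of_separable_redMat L N₁ H₁ hc hH₁ w hv hH₁w hH₁i (Subgroup.mem_prod.1 hγ).2 hsep₁)

include hc hH₂ hH₁ hH₂i hH₁i in
/-- **`hcore` for the pair group, case-free**, at every `γ ∈ K_H` whose two `w`-component matrices are residually regular: §1 per factor and ★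
`setOf_mem_prod_eq_compactCore_centralizer`. [cite: Kottwitz1986, Prop. 7.1] [cite: Tits1979, §3.9] -/
theorem setOf_mem_cmLocalIntegralLevel_prod_eq_compactCore_of_separable_redMat {γ : (cmDatum L N₂ H₂).Local v × (cmDatum L N₁ H₁).Local v}
    (hγ : γ ∈ (cmLocalIntegralLevel L N₂ H₂ v).prod (cmLocalIntegralLevel L N₁ H₁ v))
    (hγs₂ : ((γ.1.val : GL (Fin N₂) (LocalRing L v)).val.map
      (Pi.evalRingHom (fun w' : PlacesOver L v => w'.1.adicCompletion L) w)).charpoly.Separable)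
    (hsep₂ : (redMat ((γ.1.val : GL (Fin N₂) (LocalRing L v)).val.map
      (Pi.evalRingHom (fun w' : PlacesOver L v => w'.1.adicCompletion L) w))).charpoly.Separable)
    (hγs₁ : ((γ.2.val : GL (Fin N₁) (LocalRing L v)).val.map
      (Pi.evalRingHom (fun w' : PlacesOver L v => w'.1.adicCompletion L) w)).charpoly.Separable)
    (hsep₁ : (redMat ((γ.2.val : GL (Fin N₁) (LocalRing L v)).val.map
      (Pi.evalRingHom (fun w' : PlacesOver L v => w'.1.adicCompletion L) w))).charpoly.Separable) :
    {z : ↥(Subgroup.centralizer ({γ} : Set ((cmDatum L N₂ H₂).Local v × (cmDatum L N₁ H₁).Local v))) |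
        (z : (cmDatum L N₂ H₂).Local v × (cmDatum L N₁ H₁).Local v) ∈ (cmLocalIntegralLevel L N₂ H₂ v).prod (cmLocalIntegralLevel L N₁ H₁ v)} =
      compactCore ↥(Subgroup.centralizer ({γ} : Set ((cmDatum L N₂ H₂).Local v × (cmDatum L N₁ H₁).Local v))) :=
  setOf_mem_prod_eq_compactCore_centralizer (cmLocalIntegralLevel L N₂ H₂ v) (cmLocalIntegralLevel L N₁ H₁ v)
    (setOf_mem_cmLocalIntegralLevel_eq_compactCore_of_separable_redMat L N₂ H₂ hc hH₂ w hH₂w hH₂i (Subgroup.mem_prod.1 hγ).1 hγs₂ hsep₂)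
    (setOf_mem_cmLocalIntegralLevel_eq_compactCore_of_separable_redMat L N₁ H₁ hc hH₁ w hH₁w hH₁i (Subgroup.mem_prod.1 hγ).2 hγs₁ hsep₁)

variable
  [MeasurableSpace ((cmDatum L N₂ H₂).Local v × (cmDatum L N₁ H₁).Local v)] [BorelSpace ((cmDatum L N₂ H₂).Local v × (cmDatum L N₁ H₁).Local v)]
  [∀ a : (cmDatum L N₂ H₂).Local v × (cmDatum L N₁ H₁).Local v,
    MeasurableSpace (((cmDatum L N₂ H₂).Local v × (cmDatum L N₁ H₁).Local v) ⧸
      Subgroup.centralizer ({a} : Set ((cmDatum L N₂ H₂).Local v × (cmDatum L N₁ H₁).Local v)))]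
  [∀ a : (cmDatum L N₂ H₂).Local v × (cmDatum L N₁ H₁).Local v,
    BorelSpace (((cmDatum L N₂ H₂).Local v × (cmDatum L N₁ H₁).Local v) ⧸
      Subgroup.centralizer ({a} : Set ((cmDatum L N₂ H₂).Local v × (cmDatum L N₁ H₁).Local v)))]
  (νH : Measure ((cmDatum L N₂ H₂).Local v × (cmDatum L N₁ H₁).Local v)) [IsHaarMeasure νH] [νH.IsMulRightInvariant]

include hc hH₂ hH₁ hv hH₂i hH₁i in
/-- **THE UNIT ELEMENT OF THE PAIR GROUP AT A RESIDUALLY REGULAR CLASS — CLOSED, EVERY UNRAMIFIED PLACE OF GOOD REDUCTION FOR BOTH FACTORS**: for `m_H`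
canonical for `(P, ν_H)` and a `P`-class `c` with representative in `K_H = U(H₂)(𝒪_v) ×ˢ U(H₁)(𝒪_v)` whose two `w`-component matrices are residually regular:
**`classOrbitalIntegral m_H 1_{K_H} c = ν_H(K_H).toReal`** — ★ p839174 `…_prod_eq_of_isCanonical` with `hK1`, `hcore` ≔ §3 binders.
[cite: Rogawski1990, §4.3 p. 43; §4.9 Prop. 4.9.1 (b) p. 55] [cite: Kottwitz1986, Prop. 7.1] -/
theorem classOrbitalIntegral_indicator_cmLocalIntegralLevel_prod_eq_of_isCanonical_of_separable_redMat
    {P : (cmDatum L N₂ H₂).Local v × (cmDatum L N₁ H₁).Local v → Prop}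
    {m : OrbitalMeasureFamily ((cmDatum L N₂ H₂).Local v × (cmDatum L N₁ H₁).Local v)} (hm : m.IsCanonical P νH)
    (c : ConjClasses ((cmDatum L N₂ H₂).Local v × (cmDatum L N₁ H₁).Local v)) (hPc : P (Quotient.out c))
    (hγ : (Quotient.out c : (cmDatum L N₂ H₂).Local v × (cmDatum L N₁ H₁).Local v) ∈
      (cmLocalIntegralLevel L N₂ H₂ v).prod (cmLocalIntegralLevel L N₁ H₁ v))
    (hγs₂ : (((Quotient.out c : (cmDatum L N₂ H₂).Local v × (cmDatum L N₁ H₁).Local v).1.val :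
        GL (Fin N₂) (LocalRing L v)).val.map
      (Pi.evalRingHom (fun w' : PlacesOver L v => w'.1.adicCompletion L) w)).charpoly.Separable)
    (hsep₂ : (redMat (((Quotient.out c : (cmDatum L N₂ H₂).Local v × (cmDatum L N₁ H₁).Local v).1.val :
        GL (Fin N₂) (LocalRing L v)).val.map
      (Pi.evalRingHom (fun w' : PlacesOver L v => w'.1.adicCompletion L) w))).charpoly.Separable)
    (hγs₁ : (((Quotient.out c : (cmDatum L N₂ H₂).Local v × (cmDatum L N₁ H₁).Local v).2.val :
        GL (Fin N₁) (LocalRing L v)).val.map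
      (Pi.evalRingHom (fun w' : PlacesOver L v => w'.1.adicCompletion L) w)).charpoly.Separable)
    (hsep₁ : (redMat (((Quotient.out c : (cmDatum L N₂ H₂).Local v × (cmDatum L N₁ H₁).Local v).2.val :
        GL (Fin N₁) (LocalRing L v)).val.map
      (Pi.evalRingHom (fun w' : PlacesOver L v => w'.1.adicCompletion L) w))).charpoly.Separable) :
    classOrbitalIntegral m ((((cmLocalIntegralLevel L N₂ H₂ v).prod (cmLocalIntegralLevel L N₁ H₁ v) :
        Subgroup ((cmDatum L N₂ H₂).Local v × (cmDatum L N₁ H₁).Local v)) : Set ((cmDatum L N₂ H₂).Local v × (cmDatum L N₁ H₁).Local v)).indicator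
        (1 : (cmDatum L N₂ H₂).Local v × (cmDatum L N₁ H₁).Local v → ℝ)) c =
      (νH ((cmLocalIntegralLevel L N₂ H₂ v).prod (cmLocalIntegralLevel L N₁ H₁ v))).toReal :=
  classOrbitalIntegral_indicator_cmLocalIntegralLevel_prod_eq_of_isCanonical L N₂ N₁ H₂ H₁ v νH hm c hPc hγ
    (forall_exists_mem_cmLocalIntegralLevel_prod_conj_eq_of_separable_redMat L N₂ N₁ H₂ H₁ hc hH₂ hH₁ w hv hH₂w hH₁w hH₂i hH₁i hγ hsep₂ hsep₁)
    (setOf_mem_cmLocalIntegralLevel_prod_eq_compactCore_of_separable_redMat L N₂ N₁ H₂ H₁ hc hH₂ hH₁ w hH₂w hH₁w hH₂i hH₁i hγ hγs₂ hsep₂ hγs₁ hsep₁)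

include hc hH₂ hH₁ hv hH₂i hH₁i in
/-- **the letter's currency: `classOrbitalIntegral m_H (1_{K_H} : G_H → ℂ) c = 1`** at `vol K_H = 1` — the `H`-side `1_{K_H}` of ★ `IsLocalUnitTransfer` at a
residually regular class, every unramified place of good reduction for both factors; NO arithmetic binder and NO case distinction left.
[cite: Rogawski1990, §4.9 Prop. 4.9.1 (b) p. 55] [cite: Kottwitz1986, Prop. 7.1, Cor. 7.3] -/
theorem classOrbitalIntegral_indicator_complex_cmLocalIntegralLevel_prod_eq_one_of_isCanonical_of_separable_redMat
    {P : (cmDatum L N₂ H₂).Local v × (cmDatum L N₁ H₁).Local v → Prop}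
    {m : OrbitalMeasureFamily ((cmDatum L N₂ H₂).Local v × (cmDatum L N₁ H₁).Local v)} (hm : m.IsCanonical P νH)
    (c : ConjClasses ((cmDatum L N₂ H₂).Local v × (cmDatum L N₁ H₁).Local v)) (hPc : P (Quotient.out c))
    (hγ : (Quotient.out c : (cmDatum L N₂ H₂).Local v × (cmDatum L N₁ H₁).Local v) ∈
      (cmLocalIntegralLevel L N₂ H₂ v).prod (cmLocalIntegralLevel L N₁ H₁ v))
    (hγs₂ : (((Quotient.out c : (cmDatum L N₂ H₂).Local v × (cmDatum L N₁ H₁).Local v).1.val :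
        GL (Fin N₂) (LocalRing L v)).val.map
      (Pi.evalRingHom (fun w' : PlacesOver L v => w'.1.adicCompletion L) w)).charpoly.Separable)
    (hsep₂ : (redMat (((Quotient.out c : (cmDatum L N₂ H₂).Local v × (cmDatum L N₁ H₁).Local v).1.val :
        GL (Fin N₂) (LocalRing L v)).val.map
      (Pi.evalRingHom (fun w' : PlacesOver L v => w'.1.adicCompletion L) w))).charpoly.Separable)
    (hγs₁ : (((Quotient.out c : (cmDatum L N₂ H₂).Local v × (cmDatum L N₁ H₁).Local v).2.val :
        GL (Fin N₁) (LocalRing L v)).val.map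
      (Pi.evalRingHom (fun w' : PlacesOver L v => w'.1.adicCompletion L) w)).charpoly.Separable)
    (hsep₁ : (redMat (((Quotient.out c : (cmDatum L N₂ H₂).Local v × (cmDatum L N₁ H₁).Local v).2.val :
        GL (Fin N₁) (LocalRing L v)).val.map
      (Pi.evalRingHom (fun w' : PlacesOver L v => w'.1.adicCompletion L) w))).charpoly.Separable)
    (hν : νH ((cmLocalIntegralLevel L N₂ H₂ v).prod (cmLocalIntegralLevel L N₁ H₁ v)) = 1) :
    classOrbitalIntegral m ((((cmLocalIntegralLevel L N₂ H₂ v).prod (cmLocalIntegralLevel L N₁ H₁ v) :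
        Subgroup ((cmDatum L N₂ H₂).Local v × (cmDatum L N₁ H₁).Local v)) : Set ((cmDatum L N₂ H₂).Local v × (cmDatum L N₁ H₁).Local v)).indicator
        fun _ => (1 : ℂ)) c = 1 :=
  classOrbitalIntegral_indicator_complex_cmLocalIntegralLevel_prod_eq_one_of_isCanonical L N₂ N₁ H₂ H₁ v νH hm c hPc hγ
    (forall_exists_mem_cmLocalIntegralLevel_prod_conj_eq_of_separable_redMat L N₂ N₁ H₂ H₁ hc hH₂ hH₁ w hv hH₂w hH₁w hH₂i hH₁i hγ hsep₂ hsep₁)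
    (setOf_mem_cmLocalIntegralLevel_prod_eq_compactCore_of_separable_redMat L N₂ N₁ H₂ H₁ hc hH₂ hH₁ w hH₂w hH₁w hH₂i hH₁i hγ hγs₂ hsep₂ hγs₁ hsep₁) hν

end Pair

end Literature.NumberTheory.Automorphic.UnitaryGroup

end
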